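import Summits.QuantumFields.YangMills.Theorems.ContractibleFibreFibreToTorusTubeLimitStrong
import Mathlib.Probability.Martingale.Convergence
import Mathlib.MeasureTheory.Function.FactorsThrough

/-!
# Stub (T⁺) `stub_tubeMixingState` of crux `FibreToTorus` (stmt-QuantumFields-16244), line `Sketch`

The `M`-uniform free-tube family at `(β, m)` yields a probability DLR state `μ` on `ℤ⁴` that is invariant
under the two long unit translations `e₀, e₁`, is MIXING under the time shift on ALL pairs of bounded
measurable functions, and clusters in Euclidean time at the tube rate `m` on gauge-invariant local
observables.  Everything but the mixing clause is the landed `tubeLimit_strong`; the mixing clause is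
obtained from exponential clustering on bounded measurable CYLINDER functions by an `L¹(μ)`-approximation
of bounded measurable functions by bounded measurable cylinder functions (Lévy's upward theorem along an
exhausting filtration of finite coordinate sets + Doob–Dynkin factorisation, `exists_cylinder_approx`) and the
time-invariance of `μ` (to move the approximation error through the shift).
-/

noncomputable section

open scoped BigOperators Topology ENNReal
open Filter Function MeasureTheory Finset
open Literature.MathematicalPhysics.QuantumFieldTheory (haarProbability LatticeRep IsCompactSimpleLieGroup
  YMSpecies)
open Literature.Probability.LatticeModels (Site)
open Literature.MathematicalPhysics.QuantumLattice (LGConfig ZdEdge configShift configShift_apply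
  IsCylinder LocalGaugeObservable ymGibbsMeasures integrable_of_bound)

namespace Summit.QuantumFields.YangMills.Theorems.FibreToTorus

/-! ## `L¹`-approximation of bounded measurable functions by bounded cylinder functions -/

section CylinderApprox

variable {ι : Type*} {S : Type*} [MeasurableSpace S]

/-- Clamping to `[-1, 1]` does not increase the distance to a point of `[-1, 1]`. [folklore] -/
theorem abs_sub_clamp_le (a b : ℝ) (ha : |a| ≤ 1) : |a - max (-1) (min 1 b)| ≤ |a - b| := by
  obtain ⟨ha1, ha2⟩ := abs_le.1 ha
  rcases le_total b 1 with hb1 | hb1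
  · rw [min_eq_right hb1]
    rcases le_total (-1) b with hb2 | hb2
    · rw [max_eq_right hb2]
    · rw [max_eq_left hb2, abs_of_nonneg (by linarith), abs_of_nonneg (by linarith)]
      linarith
  · rw [min_eq_left hb1, max_eq_right (by norm_num : (-1 : ℝ) ≤ 1), abs_of_nonpos (by linarith),
      abs_of_nonpos (by linarith)]
    linarith

/-- **Cylinder approximation in `L¹`.**  On a countable product `ι → S` with a finite measure `μ`, every
measurable function `F` with `|F| ≤ 1` is, for every `ε > 0`, within `ε` in `L¹(μ)` of a measurable function
`F'` with `|F'| ≤ 1` depending only on the coordinates in a finite set `T` (Lévy's upward theorem for the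
filtration of finite coordinate sets, Doob–Dynkin factorisation of the conditional expectation, and a clamp
to `[-1, 1]`). [folklore] -/
theorem exists_cylinder_approx [Countable ι] (μ : Measure (ι → S)) [IsFiniteMeasure μ]
    {F : (ι → S) → ℝ} (hF : Measurable F) (hFb : ∀ x, |F x| ≤ 1) {ε : ℝ} (hε : 0 < ε) :
    ∃ (T : Finset ι) (F' : (ι → S) → ℝ), Measurable F' ∧ DependsOn F' (T : Set ι) ∧
      (∀ x, |F' x| ≤ 1) ∧ ∫ x, |F x - F' x| ∂μ ≤ ε := by
  classical
  have abs_clamp_le : ∀ b : ℝ, |max (-1) (min 1 b)| ≤ 1 := fun b =>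
    abs_le.2 ⟨le_max_left _ _, max_le (by norm_num) (min_le_left _ _)⟩
  -- an exhausting monotone sequence of finite coordinate sets
  obtain ⟨f, hf⟩ := Countable.exists_injective_nat ι
  let T : ℕ → Finset ι := fun n => (Finset.range n).preimage f hf.injOn
  have hTmono : Monotone T := fun a b hab =>
    Finset.monotone_preimage hf (Finset.range_mono hab)
  have hmemT : ∀ i, i ∈ T (f i + 1) := fun i =>
    Finset.mem_preimage.2 (Finset.mem_range.2 (Nat.lt_succ_self _))
  -- the filtration of events depending on the coordinates in `T n`
  let ℱ : Filtration ℕ (MeasurableSpace.pi : MeasurableSpace (ι → S)) :=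
    ⟨fun n => Filtration.piFinset (X := fun _ : ι => S) (T n),
      fun a b hab => (Filtration.piFinset (X := fun _ : ι => S)).mono (hTmono hab),
      fun n => (Filtration.piFinset (X := fun _ : ι => S)).le _⟩
  -- the product σ-algebra is generated by the filtration
  have hle : (MeasurableSpace.pi : MeasurableSpace (ι → S)) ≤ ⨆ n, ℱ n := by
    refine iSup_le fun i => ?_
    refine le_trans ?_ (le_iSup (fun n => (ℱ n : MeasurableSpace (ι → S))) (f i + 1))
    have hcomp : (fun b : ι → S => b i) =
        (fun g : ((T (f i + 1) : Set ι) → S) => g ⟨i, Finset.mem_coe.2 (hmemT i)⟩) ∘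
          (T (f i + 1) : Set ι).restrict := rfl
    show MeasurableSpace.comap (fun b : ι → S => b i) ‹MeasurableSpace S› ≤
      MeasurableSpace.comap (T (f i + 1) : Set ι).restrict MeasurableSpace.pi
    rw [hcomp, ← MeasurableSpace.comap_comp]
    exact MeasurableSpace.comap_mono (measurable_pi_apply _).comap_le
  have hFm : Measurable[⨆ n, ℱ n] F := hF.mono hle le_rfl
  have hFsm : StronglyMeasurable[⨆ n, ℱ n] F := hFm.stronglyMeasurable
  have hFi : Integrable F μ := integrable_of_bound hF.aestronglyMeasurable hFb
  -- Lévy's upward theorem: `μ[F | ℱ n] → F` in `L¹`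
  have hL := hFi.tendsto_eLpNorm_condExp hFsm
  obtain ⟨n, hn⟩ := ((tendsto_order.1 hL).2 (ENNReal.ofReal ε) (ENNReal.ofReal_pos.2 hε)).exists
  set g : (ι → S) → ℝ := μ[F | ℱ n] with hg_def
  have hgsm : StronglyMeasurable[Filtration.piFinset (X := fun _ : ι => S) (T n)] g :=
    stronglyMeasurable_condExp
  have hgdep : DependsOn g (T n : Set ι) := hgsm.dependsOn_of_piFinset
  have hgm : Measurable g := (stronglyMeasurable_condExp.mono (ℱ.le n)).measurable
  have hgi : Integrable g μ := integrable_condExp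
  -- `∫ |g - F| < ε`
  have hdist : ∫ x, |F x - g x| ∂μ < ε := by
    have h1 : ENNReal.ofReal (∫ x, ‖(g - F) x‖ ∂μ) = eLpNorm (g - F) 1 μ := by
      rw [ofReal_integral_norm_eq_lintegral_enorm (hgi.sub hFi), eLpNorm_one_eq_lintegral_enorm]
    have h2 : ENNReal.ofReal (∫ x, ‖(g - F) x‖ ∂μ) < ENNReal.ofReal ε := h1 ▸ hn
    have h3 : ∫ x, ‖(g - F) x‖ ∂μ < ε := (ENNReal.ofReal_lt_ofReal_iff hε).1 h2
    have h4 : (fun x => ‖(g - F) x‖) = fun x => |F x - g x| := by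
      funext x; rw [Pi.sub_apply, Real.norm_eq_abs, abs_sub_comm]
    rwa [h4] at h3
  -- clamp to `[-1, 1]`
  refine ⟨T n, fun x => max (-1) (min 1 (g x)), ?_, ?_, fun x => abs_clamp_le _, ?_⟩
  · exact measurable_const.max (measurable_const.min hgm)
  · intro x y hxy
    show max (-1) (min 1 (g x)) = max (-1) (min 1 (g y))
    rw [hgdep hxy]
  · have hci : Integrable (fun x => |F x - max (-1) (min 1 (g x))|) μ := by
      refine integrable_of_bound ?_ (C := 2) fun x => ?_
      · exact ((hF.sub (measurable_const.max (measurable_const.min hgm))).norm).aestronglyMeasurable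
      · rw [abs_abs]
        calc |F x - max (-1) (min 1 (g x))| ≤ |F x| + |max (-1) (min 1 (g x))| := abs_sub _ _
          _ ≤ 1 + 1 := add_le_add (hFb x) (abs_clamp_le _)
          _ = 2 := by norm_num
    calc ∫ x, |F x - max (-1) (min 1 (g x))| ∂μ ≤ ∫ x, |F x - g x| ∂μ :=
          integral_mono hci (hFi.sub hgi).norm fun x => abs_sub_clamp_le _ _ (hFb x)
      _ ≤ ε := hdist.le

end CylinderApprox

/-! ## Mixing on all bounded measurable functions from clustering on bounded cylinders -/

section Mixing

variable {G : Type} [MeasurableSpace G]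

/-- Translations of `ℤ⁴`-configurations compose additively. [folklore] -/
theorem configShift_configShift (v w : Site 4) (U : LGConfig 4 G) :
    configShift v (configShift w U) = configShift (v + w) U := by
  funext e
  simp only [configShift_apply, sub_sub, add_comm v w]

/-- A probability measure invariant under the unit time translation is invariant under the translations
`configShift (-(n • e₀))`, `n : ℕ`. [folklore] -/
theorem map_configShift_neg_nsmul_eq (μ : Measure (LGConfig 4 G))
    (hinv : μ.map (configShift (Pi.single 0 1)) = μ) (n : ℕ) :
    μ.map (configShift (-Pi.single 0 (n : ℤ))) = μ := by
  -- invariance under the inverse unit translation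
  have hneg : μ.map (configShift (-Pi.single 0 (1 : ℤ))) = μ := by
    have h := congrArg (fun ν : Measure (LGConfig 4 G) => ν.map (configShift (-Pi.single 0 (1 : ℤ)))) hinv
    simp only at h
    rw [Measure.map_map (configShift _).measurable (configShift _).measurable] at h
    have hid : (configShift (-Pi.single 0 (1 : ℤ)) : LGConfig 4 G → LGConfig 4 G) ∘
        (configShift (Pi.single 0 1)) = id := by
      funext U
      simp only [comp_apply, configShift_configShift, neg_add_cancel, id_eq]
      funext e
      simp [configShift_apply]
    rw [hid, Measure.map_id] at h
    exact h.symm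
  induction n with
  | zero =>
    have h0 : (configShift (-Pi.single 0 ((0 : ℕ) : ℤ)) : LGConfig 4 G → LGConfig 4 G) = id := by
      funext U; funext e; simp [configShift_apply]
    rw [h0, Measure.map_id]
  | succ k ih =>
    have hcomp : (configShift (-Pi.single 0 ((k + 1 : ℕ) : ℤ)) : LGConfig 4 G → LGConfig 4 G) =
        (configShift (-Pi.single 0 (1 : ℤ))) ∘ (configShift (-Pi.single 0 (k : ℤ))) := by
      funext U
      rw [comp_apply, configShift_configShift]
      congr 1
      rw [← neg_add, ← Pi.single_add]
      push_cast
      ring_nf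
    rw [hcomp, ← Measure.map_map (configShift _).measurable (configShift _).measurable, ih, hneg]

/-- **Time-mixing on all bounded measurable functions from exponential clustering on bounded measurable
cylinder functions** (for a probability measure on `ℤ⁴`-configurations invariant under the unit time
translation): approximate both observables in `L¹(μ)` by bounded cylinder functions (`exists_cylinder_approx`),
move the error of the shifted observable through the shift by invariance, and let the cylinder covariance
decay. [folklore] -/
theorem timeMixing_of_cylinderClustering (μ : Measure (LGConfig 4 G))
    [IsProbabilityMeasure μ] (hinv : μ.map (configShift (Pi.single 0 1)) = μ) {m : ℝ} (hm : 0 < m)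
    (hclus : ∀ (F₁ F₂ : LGConfig 4 G → ℝ) (S₁ S₂ : Finset (ZdEdge 4)), Measurable F₁ → Measurable F₂ →
      IsCylinder F₁ S₁ → IsCylinder F₂ S₂ → (∃ a : ℝ, ∀ U, |F₁ U| ≤ a) → (∃ b : ℝ, ∀ U, |F₂ U| ≤ b) →
      ∃ C : ℝ, ∀ n : ℕ,
        |(∫ U, F₁ U * F₂ (configShift (-Pi.single 0 (n : ℤ)) U) ∂μ) -
            (∫ U, F₁ U ∂μ) * (∫ U, F₂ (configShift (-Pi.single 0 (n : ℤ)) U) ∂μ)| ≤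
          C * Real.exp (-(m * n)))
    (F H : LGConfig 4 G → ℝ) (hFm : Measurable F) (hHm : Measurable H) (hFb : ∀ U, |F U| ≤ 1)
    (hHb : ∀ U, |H U| ≤ 1) :
    Tendsto (fun n : ℕ =>
      (∫ U, F U * H (configShift (-Pi.single 0 (n : ℤ)) U) ∂μ) -
        (∫ U, F U ∂μ) * ∫ U, H (configShift (-Pi.single 0 (n : ℤ)) U) ∂μ) atTop (𝓝 0) := by
  rw [Metric.tendsto_atTop]
  intro ε hε
  -- cylinder approximants within `ε / 8`
  have hε8 : 0 < ε / 8 := by positivity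
  obtain ⟨S₁, F', hF'm, hF'd, hF'b, hF'a⟩ := exists_cylinder_approx μ hFm hFb hε8
  obtain ⟨S₂, H', hH'm, hH'd, hH'b, hH'a⟩ := exists_cylinder_approx μ hHm hHb hε8
  obtain ⟨C, hC⟩ := hclus F' H' S₁ S₂ hF'm hH'm hF'd hH'd ⟨1, hF'b⟩ ⟨1, hH'b⟩
  -- the cylinder covariance is eventually `< ε / 2`
  have hdecay : Tendsto (fun n : ℕ => C * Real.exp (-(m * n))) atTop (𝓝 0) := by
    have h1 : Tendsto (fun n : ℕ => m * (n : ℝ)) atTop atTop :=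
      (tendsto_natCast_atTop_atTop).const_mul_atTop hm
    have h2 : Tendsto (fun n : ℕ => Real.exp (-(m * n))) atTop (𝓝 0) :=
      Real.tendsto_exp_neg_atTop_nhds_zero.comp h1
    simpa using h2.const_mul C
  obtain ⟨N, hN⟩ := (Metric.tendsto_atTop.1 hdecay) (ε / 2) (by positivity)
  refine ⟨N, fun n hn => ?_⟩
  have hCn : C * Real.exp (-(m * n)) < ε / 2 := by
    have := hN n hn
    rw [Real.dist_eq, sub_zero] at this
    exact lt_of_abs_lt this
  -- notation
  set s : LGConfig 4 G → LGConfig 4 G := (configShift (-Pi.single 0 (n : ℤ) : Site 4) : LGConfig 4 G → LGConfig 4 G)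
    with hs
  have hsm : Measurable s := (configShift _).measurable
  have hμs : μ.map s = μ := map_configShift_neg_nsmul_eq μ hinv n
  -- integrability of everything in sight
  have iF : Integrable F μ := integrable_of_bound hFm.aestronglyMeasurable hFb
  have iF' : Integrable F' μ := integrable_of_bound hF'm.aestronglyMeasurable hF'b
  have iHs : Integrable (fun U => H (s U)) μ :=
    integrable_of_bound (hHm.comp hsm).aestronglyMeasurable fun U => hHb _
  have iH's : Integrable (fun U => H' (s U)) μ :=
    integrable_of_bound (hH'm.comp hsm).aestronglyMeasurable fun U => hH'b _
  have hbFH : ∀ U, |F U * H (s U)| ≤ 1 := fun U => by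
    rw [abs_mul]; exact mul_le_one₀ (hFb U) (abs_nonneg _) (hHb _)
  have hbF'H' : ∀ U, |F' U * H' (s U)| ≤ 1 := fun U => by
    rw [abs_mul]; exact mul_le_one₀ (hF'b U) (abs_nonneg _) (hH'b _)
  have iFH : Integrable (fun U => F U * H (s U)) μ :=
    integrable_of_bound (hFm.mul (hHm.comp hsm)).aestronglyMeasurable hbFH
  have iF'H' : Integrable (fun U => F' U * H' (s U)) μ :=
    integrable_of_bound (hF'm.mul (hH'm.comp hsm)).aestronglyMeasurable hbF'H'
  have iF'H : Integrable (fun U => F' U * H (s U)) μ :=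
    integrable_of_bound (hF'm.mul (hHm.comp hsm)).aestronglyMeasurable fun U => by
      rw [abs_mul]; exact mul_le_one₀ (hF'b U) (abs_nonneg _) (hHb _)
  -- the shifted approximation error, moved through the shift by invariance
  have hHerr : ∫ U, |H (s U) - H' (s U)| ∂μ ≤ ε / 8 := by
    have h := integral_map (μ := μ) hsm.aemeasurable (f := fun U => |H U - H' U|)
      ((hHm.sub hH'm).norm.aestronglyMeasurable)
    rw [hμs] at h
    rw [← h]
    exact hH'a
  -- one-point differences
  have hbound1 : ∀ (f g : LGConfig 4 G → ℝ), Integrable f μ → Integrable g μ →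
      |(∫ U, f U ∂μ) - ∫ U, g U ∂μ| ≤ ∫ U, |f U - g U| ∂μ := fun f g hf hg => by
    rw [← integral_sub hf hg]
    exact abs_integral_le_integral_abs
  have dF : |(∫ U, F U ∂μ) - ∫ U, F' U ∂μ| ≤ ε / 8 := (hbound1 F F' iF iF').trans hF'a
  have dH : |(∫ U, H (s U) ∂μ) - ∫ U, H' (s U) ∂μ| ≤ ε / 8 := (hbound1 _ _ iHs iH's).trans hHerr
  -- two-point difference
  have dFH : |(∫ U, F U * H (s U) ∂μ) - ∫ U, F' U * H' (s U) ∂μ| ≤ ε / 8 + ε / 8 := by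
    have step1 : |(∫ U, F U * H (s U) ∂μ) - ∫ U, F' U * H (s U) ∂μ| ≤ ε / 8 := by
      refine (hbound1 _ _ iFH iF'H).trans ?_
      calc ∫ U, |F U * H (s U) - F' U * H (s U)| ∂μ ≤ ∫ U, |F U - F' U| ∂μ := by
            refine integral_mono (iFH.sub iF'H).norm (iF.sub iF').norm fun U => ?_
            show |F U * H (s U) - F' U * H (s U)| ≤ |F U - F' U|
            rw [← sub_mul, abs_mul]
            exact mul_le_of_le_one_right (abs_nonneg _) (hHb _)
        _ ≤ ε / 8 := hF'a
    have step2 : |(∫ U, F' U * H (s U) ∂μ) - ∫ U, F' U * H' (s U) ∂μ| ≤ ε / 8 := by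
      refine (hbound1 _ _ iF'H iF'H').trans ?_
      calc ∫ U, |F' U * H (s U) - F' U * H' (s U)| ∂μ ≤ ∫ U, |H (s U) - H' (s U)| ∂μ := by
            refine integral_mono (iF'H.sub iF'H').norm (iHs.sub iH's).norm fun U => ?_
            show |F' U * H (s U) - F' U * H' (s U)| ≤ |H (s U) - H' (s U)|
            rw [← mul_sub, abs_mul]
            exact mul_le_of_le_one_left (abs_nonneg _) (hF'b _)
        _ ≤ ε / 8 := hHerr
    calc |(∫ U, F U * H (s U) ∂μ) - ∫ U, F' U * H' (s U) ∂μ|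
        = |((∫ U, F U * H (s U) ∂μ) - ∫ U, F' U * H (s U) ∂μ) +
            ((∫ U, F' U * H (s U) ∂μ) - ∫ U, F' U * H' (s U) ∂μ)| := by ring_nf
      _ ≤ _ := (abs_add_le _ _).trans (add_le_add step1 step2)
  -- a-priori bounds on the one-point integrals
  have hint1 : ∀ (f : LGConfig 4 G → ℝ), (∀ U, |f U| ≤ 1) → |∫ U, f U ∂μ| ≤ 1 := fun f hf => by
    refine (abs_integral_le_integral_abs).trans ?_
    calc ∫ U, |f U| ∂μ ≤ ∫ _U, (1 : ℝ) ∂μ := integral_mono_of_nonneg (ae_of_all _ fun U => abs_nonneg _)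
          (integrable_const _) (ae_of_all _ hf)
      _ = 1 := by simp
  have bF' : |∫ U, F' U ∂μ| ≤ 1 := hint1 F' hF'b
  have bHs : |∫ U, H (s U) ∂μ| ≤ 1 := hint1 _ fun U => hHb _
  -- product of one-point functions
  have dprod : |(∫ U, F U ∂μ) * (∫ U, H (s U) ∂μ) - (∫ U, F' U ∂μ) * ∫ U, H' (s U) ∂μ| ≤
      ε / 8 + ε / 8 := by
    set a := ∫ U, F U ∂μ
    set a' := ∫ U, F' U ∂μ
    set b := ∫ U, H (s U) ∂μ
    set b' := ∫ U, H' (s U) ∂μ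
    calc |a * b - a' * b'| = |(a - a') * b + a' * (b - b')| := by ring_nf
      _ ≤ |(a - a') * b| + |a' * (b - b')| := abs_add_le _ _
      _ ≤ ε / 8 + ε / 8 := by
        rw [abs_mul, abs_mul]
        exact add_le_add ((mul_le_of_le_one_right (abs_nonneg _) bHs).trans dF)
          ((mul_le_of_le_one_left (abs_nonneg _) bF').trans dH)
  -- assemble
  rw [Real.dist_eq, sub_zero]
  have key : |((∫ U, F U * H (s U) ∂μ) - (∫ U, F U ∂μ) * ∫ U, H (s U) ∂μ) -
      ((∫ U, F' U * H' (s U) ∂μ) - (∫ U, F' U ∂μ) * ∫ U, H' (s U) ∂μ)| ≤ ε / 2 := by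
    calc _ = |((∫ U, F U * H (s U) ∂μ) - ∫ U, F' U * H' (s U) ∂μ) -
          ((∫ U, F U ∂μ) * (∫ U, H (s U) ∂μ) - (∫ U, F' U ∂μ) * ∫ U, H' (s U) ∂μ)| := by ring_nf
      _ ≤ (ε / 8 + ε / 8) + (ε / 8 + ε / 8) := (abs_sub _ _).trans (add_le_add dFH dprod)
      _ = ε / 2 := by ring
  have hcyl : |(∫ U, F' U * H' (s U) ∂μ) - (∫ U, F' U ∂μ) * ∫ U, H' (s U) ∂μ| < ε / 2 :=
    (hC n).trans_lt hCn
  have htri : ∀ x y : ℝ, |x| ≤ |x - y| + |y| := fun x y => by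
    calc |x| = |(x - y) + y| := by ring_nf
      _ ≤ |x - y| + |y| := abs_add_le _ _
  calc |(∫ U, F U * H (s U) ∂μ) - (∫ U, F U ∂μ) * ∫ U, H (s U) ∂μ|
      ≤ |((∫ U, F U * H (s U) ∂μ) - (∫ U, F U ∂μ) * ∫ U, H (s U) ∂μ) -
          ((∫ U, F' U * H' (s U) ∂μ) - (∫ U, F' U ∂μ) * ∫ U, H' (s U) ∂μ)| +
        |(∫ U, F' U * H' (s U) ∂μ) - (∫ U, F' U ∂μ) * ∫ U, H' (s U) ∂μ| := htri _ _
    _ < ε / 2 + ε / 2 := add_lt_add_of_le_of_lt key hcyl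
    _ = ε := by ring

end Mixing

/-! ## The registered stub -/

section Stub

/-- **Stub (T⁺) `stub_tubeMixingState` of line `Sketch`** (registered signature, verbatim): the `M`-uniform
free-tube family at `(β, m)` yields a probability DLR state on `ℤ⁴`, invariant under the long unit translations
`e₀, e₁`, mixing under the time shift on all pairs of bounded measurable functions, and clustering in time at
rate `m` on gauge-invariant local observables.  Proof: `tubeLimit_strong` gives everything except mixing, with
clustering on all bounded measurable cylinder functions; `timeMixing_of_cylinderClustering` upgrades the latter
to mixing. -/
theorem stub_tubeMixingState :
    ∀ (G : Type) [Group G] [TopologicalSpace G] [IsTopologicalGroup G] [CompactSpace G]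
      [MeasurableSpace G] [BorelSpace G], IsCompactSimpleLieGroup G → ∀ r : LatticeRep G,
      let Tube := fun (M : ℕ) (β m C : ℝ) (w Lmin : ℕ) => ∀ (L : ℕ) [NeZero L], Lmin ≤ L →
        let St := ZMod L × ZMod L × Fin (M + 1) × Fin (M + 1);
        let Cfg := St × Fin 4 → G;
        let ν : MeasureTheory.Measure Cfg := MeasureTheory.Measure.pi fun _ => haarProbability G;
        let sh : St → Fin 4 → St := fun x μ => ![(x.1 + 1, x.2.1, x.2.2.1, x.2.2.2), (x.1, x.2.1 + 1, x.2.2.1, x.2.2.2), (x.1, x.2.1, x.2.2.1 + 1, x.2.2.2), (x.1, x.2.1, x.2.2.1, x.2.2.2 + 1)] μ;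
        let ins : St → Fin 4 → Fin 4 → ℝ := fun x μ κ => if ((μ = 2 ∨ κ = 2) → (x.2.2.1 : ℕ) < M) ∧ ((μ = 3 ∨ κ = 3) → (x.2.2.2 : ℕ) < M) then 1 else 0;
        let pl : Cfg → St → Fin 4 → Fin 4 → G := fun U x μ κ => U (x, μ) * U (sh x μ, κ) * (U (sh x κ, μ))⁻¹ * (U (x, κ))⁻¹;
        let act : Cfg → ℝ := fun U => β * ∑ x : St, ∑ q : {q : Fin 4 × Fin 4 // q.1 < q.2}, ins x q.1.1 q.1.2 * (r.ρ (pl U x q.1.1 q.1.2)).trace.re;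
        let wgt : Cfg → ℝ := fun U => Real.exp (act U);
        let Ex : (Cfg → ℝ) → ℝ := fun F => (∫ U, F U * wgt U ∂ν) / (∫ U, wgt U ∂ν);
        let σ : ℕ → Cfg → Cfg := fun n U p => U ((p.1.1 + n, p.1.2), p.2);
        ∀ c : ZMod L,
        let Loc := fun F : Cfg → ℝ => Measurable F ∧ (∀ U, |F U| ≤ 1) ∧ ∀ U U', (∀ p : St × Fin 4, (p.1.1 - c).val ≤ w → U p = U' p) → F U = F U';
        ∀ F₁ F₂ : Cfg → ℝ, Loc F₁ → Loc F₂ → ∀ n : ℕ, 2 * n < L → |Ex (fun U => F₁ U * F₂ (σ n U)) - Ex F₁ * Ex (fun U => F₂ (σ n U))| ≤ C * Real.exp (-(m * n));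
      ∀ (β m : ℝ), 0 < m → (∀ w : ℕ, ∃ C : ℝ, ∀ M : ℕ, ∃ Lmin : ℕ, Tube M β m C w Lmin) →
        ∃ μ : MeasureTheory.Measure (LGConfig 4 G), MeasureTheory.IsProbabilityMeasure μ ∧
          μ ∈ ymGibbsMeasures (d := 4) r.ρ β ∧
          (μ.map (configShift (Pi.single 0 1)) = μ ∧ μ.map (configShift (Pi.single 1 1)) = μ) ∧
          (∀ F H : LGConfig 4 G → ℝ, Measurable F → Measurable H → (∀ U, |F U| ≤ 1) → (∀ U, |H U| ≤ 1) →
            Filter.Tendsto (fun n : ℕ =>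
              (∫ U, F U * H (configShift (-Pi.single 0 (n : ℤ)) U) ∂μ) -
                (∫ U, F U ∂μ) * ∫ U, H (configShift (-Pi.single 0 (n : ℤ)) U) ∂μ) Filter.atTop (nhds 0)) ∧
          ∀ A B : YMSpecies G, ∃ C : ℝ, ∀ n : ℕ,
            |(∫ U, A.F U * B.F (configShift (-Pi.single 0 (n : ℤ)) U) ∂μ) -
                (∫ U, A.F U ∂μ) * (∫ U, B.F (configShift (-Pi.single 0 (n : ℤ)) U) ∂μ)| ≤
              C * Real.exp (-(m * n)) := by
  intro G _ _ _ _ _ _ hG r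
  dsimp only
  intro β m hm hfam
  obtain ⟨μ, hμP, hμG, h0, h1, hclus⟩ := tubeLimit_strong G hG r β m hm hfam
  refine ⟨μ, hμP, hμG, ⟨h0, h1⟩, ?_, ?_⟩
  · intro F H hF hH hFb hHb
    exact timeMixing_of_cylinderClustering μ h0 hm hclus F H hF hH hFb hHb
  · intro A B
    exact hclus A.F B.F A.supp B.supp A.measurable B.measurable A.isCylinder B.isCylinder A.bounded
      B.bounded

end Stub

end Summit.QuantumFields.YangMills.Theorems.FibreToTorus

end
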